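import Summits.HodgeConjecture.HodgeConjecture.Theses.PadicSemiregularLift
import Summits.HodgeConjecture.HodgeConjecture.Theorems.PadicSemiregularLiftFermatAnchorAssemblyDefs
import Summits.HodgeConjecture.HodgeConjecture.Theorems.HodgeFermatVarieties.Negative.DegreeZeroVacuous
import Literature.AlgebraicGeometry.Motives.Jacobian
import Literature.AlgebraicGeometry.Motives.SupersingularAbelianVariety
import Literature.AlgebraicGeometry.Motives.MotivatedPeriodTorsor
import Literature.AlgebraicGeometry.HodgeTheory.FermatHypersurfaceReduction
import Literature.AlgebraicGeometry.HodgeTheory.ComplexConjugationHolds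
import Literature.AlgebraicGeometry.HodgeTheory.FermatHodgeClassesLiftToCurveAndJacobianPowers
import Literature.AlgebraicGeometry.HodgeTheory.FermatHodgeClassesLiftToCurvePowersSum

/-!
# Crux `FermatAnchorAssembly` (stmt-HodgeConjecture-14874), line `Sketch` (parallelizable-avatar):
# the transfer stub REPAIRED over the multi-host Shioda–Katsura fact (`stub_transfer_of_facts_sum`)

Route `PadicSemiregularLift` of `HodgeConjecture`; skeleton
`Cruxes/FermatAnchorAssembly/Lines/Sketch.lean`, vocabulary
`Theorems/PadicSemiregularLiftFermatAnchorAssemblyDefs.lean` (`HodgeFermatJacobianPowersAt`);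
companion of `Theorems/PadicSemiregularLiftFermatAnchorAssemblyStubTransfer.lean`, whose
`stub_transfer_of_facts` closes the transfer stub

  `stub_transfer : (∀ m C 𝒥, HodgeFermatJacobianPowersAt m C 𝒥) → HodgeFermatVarieties`

MODULO the named fact `Literature.AlgebraicGeometry.HodgeTheory.FermatHodgeClassesLiftToCurvePowers`
(single host `C_mⁿ`, same degree `2p`). That fact is FALSE as stated (triage 2026-08-16): at
`(m, n, p) = (3, 2, 1)` the single host `C₃ × C₃` (`C₃` the Fermat cubic, genus `1`) has
`dim_ℂ H²(C₃ × C₃) = 1 + 2·2 + 1 = 6`, while the Fermat cubic surface `X²₃` has `b₂ = 7` with all of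
`H²(X²₃; ℚ) ≅ ℚ⁷` rational of type `(1, 1)` (the 27 lines), so no single linear
`F : H²(C₃²) → H²(X²₃)` has every rational `(1,1)`-class in its range. Root cause: the domination of
`Xⁿₘ` by `C_mⁿ` (Shioda–Katsura 1979, §1) is only RATIONAL; Shioda 1979, Thm. I:
`H^{r+s}_prim(X^{r+s}ₘ) ≅ [Hʳ_prim(Xʳₘ) ⊗ Hˢ_prim(Xˢₘ)]^{μₘ} ⊕ [H^{r-1}_prim(X^{r-1}ₘ) ⊗ H^{s-1}_prim(X^{s-1}ₘ)](-1)`,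
the Tate-twisted summand coming from the exceptional divisor of the blow-up resolving the rational
map; iterating, `H*(Xⁿₘ)` is assembled from the `[H¹(C_m)^{⊗(n-2j)}](-j)`, i.e. from SEVERAL hosts
`C_m^{n-2j}` in SHIFTED degrees `2(p - j)`.

This file lands the repair:

* `FermatHodgeClassesLiftToCurvePowersSum` — the corrected named fact, multi-host finite-sum form
  (landed as `Literature/AlgebraicGeometry/HodgeTheory/FermatHodgeClassesLiftToCurvePowersSum.lean`): for `m, n ≥ 1` and
  every `p` there are finitely many hosts `C_m^{kᵢ}` with degrees `2qᵢ` and `ℂ`-linear maps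
  `Fᵢ : H^{2qᵢ}(C_m^{kᵢ}(ℂ); ℂ) → H²ᵖ(Xⁿₘ(ℂ); ℂ)` carrying algebraic classes to algebraic classes,
  such that every rational `(p,p)`-class on `Xⁿₘ` is `Σᵢ Fᵢ aᵢ` with `aᵢ` rational of type
  `(qᵢ, qᵢ)` on `C_m^{kᵢ}` (hosts `(kᵢ, qᵢ) = (n - 2j, p - j)`; `kᵢ = 0` is the point `Spec ℂ`);
* `mem_algebraicClasses_fermatCurvePow_of_facts` — ONE host: granted the Abel–Jacobi fact
  `CurvePowerHodgeClassesLiftToJacobianPowers`, Milne's existence theorem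
  `Motives.nonempty_jacobian_of_isSmoothProjective` and the stub's hypothesis (HC for all powers of
  all Jacobians of the Fermat curves), every rational `(q,q)`-class on `C_mᴷ` is algebraic
  (`K = N + 1`: `a = (a - G b) + G b` with `b` rational `(q,q)` on `J(C_m)ᴺ⁺¹`, algebraic by the
  hypothesis; `K = 0`: `C_m⁰ = Spec ℂ` is smooth projective of dimension `0`, so every class of
  every `H²q` is algebraic, `algebraicClasses_eq_top_of_eq_zero_or_le`);
* `mem_algebraicClasses_fermatHypersurface_of_facts_sum` — the kernel on the standard model:
  `c = Σᵢ Fᵢ aᵢ`, each `aᵢ` algebraic by the one-host lemma, each `Fᵢ aᵢ` algebraic, finite sums of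
  algebraic classes are algebraic (`Submodule.sum_mem`);
* `hodgeFermatVarieties_of_fermatHypersurface` — the transport: if every rational `(p,p)`-class
  on every standard model `V₊(Σ xᵢᵐ) ⊂ ℙⁿ⁺¹_ℂ`, `m, n ≥ 1`, is algebraic, then
  `HodgeFermatVarieties` (`m = 0` contradictory, `degree_zero_vacuous`; `n = 0` unconditional,
  `hodgeClasses_algebraic_fermat_of_dim_le_one`; Hodge models by `nonempty_hodgeModel_holds`;
  transport along `IsFermatVariety.isoFermatHypersurface` by `IsRationalClass.map`,
  `IsOfHodgeType.map_of_iso`, `mem_algebraicClasses_map_of_iso`, `map_hom_map_inv_apply` — the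
  pattern of `hodgeClasses_algebraic_fermat_middle_of_fermatHypersurface`);
* `stub_transfer_of_facts_sum` — the registered sub-goal: the corrected fact, the Abel–Jacobi
  fact, Milne's existence theorem and the stub's hypothesis imply `HodgeFermatVarieties`.

Small / junk cases of the corrected fact, analysed (it is `∃`-hosts, so truth needs ONE good
choice of hosts per `(m, n, p)`): `m = 1, 2` (`Xⁿₘ` a hyperplane / a quadric, `C_m ≅ ℙ¹`): all of
`H²ᵖ(Xⁿₘ; ℚ)` is algebraic and one may take point hosts `kᵢ = 0`, `qᵢ = 0`, `Fᵢ 1 = ` an algebraic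
basis vector (`hᵖ`, rulings); `p = 0`: `H⁰ = ℚ · 1`, one point host with `F 1 = 1`; `2p > 2n`: the
target vanishes, no hosts (`ι` empty, `c = 0 =` the empty sum); `n` odd or `2p ≠ n`:
`H²ᵖ(Xⁿₘ; ℚ) = ℚ hᵖ` (Lefschetz), one point host; `2p = n`: the printed inductive structure. The
hypothesis `1 ≤ n` is kept for parallelism (for `n = 0`, `X⁰ₘ` = `m` points, point hosts would
still do). In the transfer only `m, n ≥ 1` is used.
-/

-- `Summit.HodgeConjecture.HodgeConjecture.…` is the tree's mandated summit/problem namespace (single-problem summit).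
set_option linter.dupNamespace false

noncomputable section

open CategoryTheory AlgebraicGeometry
open Literature.AlgebraicGeometry Literature.AlgebraicGeometry.Motives
  Literature.AlgebraicGeometry.HodgeTheory
open Literature.AlgebraicTopology.SingularHomology

namespace Summit.HodgeConjecture.HodgeConjecture.Cruxes.FermatAnchorAssembly.ParallelizableAvatar

/-! ## The transfer, modulo the facts -/

/-- **One host.** Granted the Abel–Jacobi fact `CurvePowerHodgeClassesLiftToJacobianPowers`, the
existence of Jacobians (Milne Thm. 1.1, `Motives.nonempty_jacobian_of_isSmoothProjective`) and the
hypothesis of the stub (HC for all powers of all Jacobians of all smooth projective Fermat curves),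
every rational `(q,q)`-class `a` on a power `C_mᴷ = (fermatHypersurface 1 m).pow K` of the standard
Fermat curve, `m ≥ 1`, is algebraic: for `K = N + 1`, `a - G b` is algebraic with `b` rational
`(q,q)` on `J(C_m)ᴺ⁺¹ = (𝒥.J.powSucc N).X` (`𝒥` a Jacobian of `C_m`, a smooth projective Fermat
curve: `isSmoothProjective_fermatHypersurface`, `isFermatVariety_fermatHypersurface`), `b` is
algebraic by the hypothesis at `(m, C_m, 𝒥, N)`, hence so are `G b` and `a = (a - G b) + G b`; for
`K = 0`, `C_m⁰ = Spec ℂ` is smooth projective of dimension `0` (`isSmoothProjective_unit_holds`),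
so every class of every `H²q` is algebraic (`algebraicClasses_eq_top_of_eq_zero_or_le`).
[cite: Milne1986JacobianVarieties, Thm. 1.1 and §6 Prop. 6.4] -/
theorem mem_algebraicClasses_fermatCurvePow_of_facts
    (hAJ : Literature.AlgebraicGeometry.HodgeTheory.CurvePowerHodgeClassesLiftToJacobianPowers)
    (hJ : nonempty_jacobian_of_isSmoothProjective.{0})
    (H : ∀ (m : ℕ) (C : SchemeOver ℂ) (𝒥 : Jacobian C), HodgeFermatJacobianPowersAt m C 𝒥)
    {m : ℕ} (hm : 1 ≤ m) (K q : ℕ) (a : complexBetti ((fermatHypersurface 1 m).pow K) (2 * q))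
    (ha : IsRationalClass a) (haH : IsOfHodgeType K ((fermatHypersurface 1 m).pow K) (2 * q) q q a) :
    a ∈ algebraicClasses ((fermatHypersurface 1 m).pow K) q := by
  cases K with
  | zero =>
    have h0 : IsSmoothProjective 0 ((fermatHypersurface 1 m).pow 0) := isSmoothProjective_unit_holds ℂ
    rw [algebraicClasses_eq_top_of_eq_zero_or_le h0 (Or.inr (Nat.zero_le q))]
    exact Submodule.mem_top
  | succ N =>
    have hC : IsSmoothProjective 1 (fermatHypersurface 1 m) :=
      isSmoothProjective_fermatHypersurface le_rfl hm
    have hCF : IsFermatVariety 1 m (fermatHypersurface 1 m) := isFermatVariety_fermatHypersurface hm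
    obtain ⟨𝒥⟩ := hJ ℂ (fermatHypersurface 1 m) hC
    have HJ : HodgeConjectureFor (𝒥.J.powSucc N).dim (𝒥.J.powSucc N).X := H m _ 𝒥 hCF hC N
    obtain ⟨G, hGalg, hGlift⟩ := hAJ (fermatHypersurface 1 m) hC 𝒥 N q
    obtain ⟨b, hbrat, hbpp, hdiff⟩ := hGlift a ha haH
    have hb : b ∈ algebraicClasses (𝒥.J.powSucc N).X q := HJ.2 q b hbrat hbpp
    have hGb : G b ∈ algebraicClasses ((fermatHypersurface 1 m).pow (N + 1)) q := hGalg b hb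
    have := Submodule.add_mem _ hdiff hGb
    rwa [sub_add_cancel] at this

/-- **The kernel on the standard model, multi-host.** Granted the corrected Shioda–Katsura fact
`FermatHodgeClassesLiftToCurvePowersSum`, the Abel–Jacobi fact, the existence of Jacobians and
the hypothesis of the stub, every rational `(p,p)`-class `c` on the standard Fermat variety
`V₊(Σᵢ xᵢᵐ) ⊂ ℙⁿ⁺¹_ℂ`, `m, n ≥ 1`, is algebraic: `c = Σᵢ Fᵢ aᵢ` with `aᵢ` rational `(qᵢ,qᵢ)` on
the host `C_m^{kᵢ}`, each `aᵢ` is algebraic (`mem_algebraicClasses_fermatCurvePow_of_facts`), so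
is each `Fᵢ aᵢ`, and finite sums of algebraic classes are algebraic (`Submodule.sum_mem`).
[cite: ShiodaKatsura1979, §1 Thm. 1.7] [cite: Shioda1979HodgeFermat, Thm. I] -/
theorem mem_algebraicClasses_fermatHypersurface_of_facts_sum
    (hSK : Literature.AlgebraicGeometry.HodgeTheory.FermatHodgeClassesLiftToCurvePowersSum)
    (hAJ : Literature.AlgebraicGeometry.HodgeTheory.CurvePowerHodgeClassesLiftToJacobianPowers)
    (hJ : nonempty_jacobian_of_isSmoothProjective.{0})
    (H : ∀ (m : ℕ) (C : SchemeOver ℂ) (𝒥 : Jacobian C), HodgeFermatJacobianPowersAt m C 𝒥)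
    {m n : ℕ} (hm : 1 ≤ m) (hn : 1 ≤ n) (p : ℕ) (c : complexBetti (fermatHypersurface n m) (2 * p))
    (hc : IsRationalClass c) (hpp : IsOfHodgeType n (fermatHypersurface n m) (2 * p) p p c) :
    c ∈ algebraicClasses (fermatHypersurface n m) p := by
  obtain ⟨ι, _, k, q, F, hFalg, hFlift⟩ := hSK m n p hm hn
  obtain ⟨a, ha, rfl⟩ := hFlift c hc hpp
  exact Submodule.sum_mem _ fun i _ ↦ hFalg i _
    (mem_algebraicClasses_fermatCurvePow_of_facts hAJ hJ H hm (k i) (q i) (a i) (ha i).1 (ha i).2)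

/-- **Transport to the standard model.** If every rational `(p,p)`-class on every standard Fermat
variety `V₊(Σᵢ xᵢᵐ) ⊂ ℙⁿ⁺¹_ℂ` with `m, n ≥ 1` is algebraic, then `HodgeFermatVarieties` holds (HC
for every smooth projective complex `X` with `IsFermatVariety n m X`, all `n`, `m`): the
anti-vacuity conjunct is `nonempty_hodgeModel_holds`; `m = 0` is contradictory
(`degree_zero_vacuous`: `V₊(n+2) = ∅` is not geometrically irreducible); `n = 0` is
`hodgeClasses_algebraic_fermat_of_dim_le_one`; otherwise transport the class along
`e = IsFermatVariety.isoFermatHypersurface : X ≅ V₊(Σ xᵢᵐ)` (`(e⁻¹)^* c` is rational and of type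
`(p,p)` by `IsRationalClass.map`, `IsOfHodgeType.map_of_iso`), use the hypothesis, and come back
with `mem_algebraicClasses_map_of_iso` and `e^*(e⁻¹)^* c = c` (`map_hom_map_inv_apply`) — the
pattern of `hodgeClasses_algebraic_fermat_middle_of_fermatHypersurface`.
[cite: Hartshorne1977, II Ex. 3.11 (d)] -/
theorem hodgeFermatVarieties_of_fermatHypersurface
    (hstd : ∀ ⦃m n : ℕ⦄, 1 ≤ m → 1 ≤ n → ∀ (p : ℕ)
      (c : complexBetti (fermatHypersurface n m) (2 * p)), IsRationalClass c →
        IsOfHodgeType n (fermatHypersurface n m) (2 * p) p p c →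
          c ∈ algebraicClasses (fermatHypersurface n m) p) :
    Theses.PadicSemiregularLift.HodgeFermatVarieties := by
  intro n m X hF hX
  refine ⟨nonempty_hodgeModel_holds hX, fun p c hc hpp => ?_⟩
  rcases Nat.eq_zero_or_pos m with rfl | hm
  · exact (Summit.HodgeConjecture.HodgeConjecture.Theorems.HodgeFermatVarietiesNegative.degree_zero_vacuous
      hF hX).elim
  rcases Nat.eq_zero_or_pos n with rfl | hn
  · exact hodgeClasses_algebraic_fermat_of_dim_le_one (by omega) hX p c
  -- transport to the standard model `V₊(Σ xᵢᵐ)`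
  have hX' : IsSmoothProjective n (fermatHypersurface n m) := isSmoothProjective_fermatHypersurface hn hm
  let e : X ≅ fermatHypersurface n m := hF.isoFermatHypersurface
  set c' : complexBetti (fermatHypersurface n m) (2 * p) :=
    singularCohomology.map ℂ ℂ (Motives.AlgPoints.mapContinuous (L := ℂ) e.inv) (2 * p) c with hc'
  have hc'rat : IsRationalClass c' := hc.map _
  have hc'pp : IsOfHodgeType n (fermatHypersurface n m) (2 * p) p p c' := hpp.map_of_iso e.symm
  have hc'alg : c' ∈ algebraicClasses (fermatHypersurface n m) p := hstd hm hn p c' hc'rat hc'pp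
  have := mem_algebraicClasses_map_of_iso hX' hX e hc'alg
  rwa [hc', show complexBetti.map e.hom (2 * p)
      (singularCohomology.map ℂ ℂ (Motives.AlgPoints.mapContinuous (L := ℂ) e.inv) (2 * p) c) = c from
    map_hom_map_inv_apply e (2 * p) c] at this

/-- **Registered sub-goal `stub_transfer_of_facts_sum`: the transfer stub modulo the CORRECTED
printed fact, the Abel–Jacobi fact and Milne's existence theorem.** From
`FermatHodgeClassesLiftToCurvePowersSum` (Shioda–Katsura §1 / Shioda Thm. I, multi-host
Hodge-class form), `CurvePowerHodgeClassesLiftToJacobianPowers` (Abel–Jacobi) and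
`Motives.nonempty_jacobian_of_isSmoothProjective` (Milne Thm. 1.1), HC for all powers of the
Fermat Jacobians implies `HodgeFermatVarieties` (HC for every smooth projective complex Fermat
hypersurface, all `n`, `m`): `hodgeFermatVarieties_of_fermatHypersurface` applied to the kernel
`mem_algebraicClasses_fermatHypersurface_of_facts_sum`. Hence
`stub_transfer = stub_transfer_of_facts_sum hSK hAJ hJ` once the three facts are discharged.
[cite: ShiodaKatsura1979, §1 Thm. 1.7] [cite: Shioda1979HodgeFermat, Thm. I]
[cite: Milne1986JacobianVarieties, Thm. 1.1 and §6 Prop. 6.4] -/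
theorem stub_transfer_of_facts_sum : Literature.AlgebraicGeometry.HodgeTheory.FermatHodgeClassesLiftToCurvePowersSum → Literature.AlgebraicGeometry.HodgeTheory.CurvePowerHodgeClassesLiftToJacobianPowers → nonempty_jacobian_of_isSmoothProjective.{0} → (∀ (m : ℕ) (C : SchemeOver ℂ) (𝒥 : Jacobian C), HodgeFermatJacobianPowersAt m C 𝒥) → Theses.PadicSemiregularLift.HodgeFermatVarieties :=
  fun hSK hAJ hJ H ↦ hodgeFermatVarieties_of_fermatHypersurface
    fun _ _ hm hn p c hc hpp ↦
      mem_algebraicClasses_fermatHypersurface_of_facts_sum hSK hAJ hJ H hm hn p c hc hpp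

end Summit.HodgeConjecture.HodgeConjecture.Cruxes.FermatAnchorAssembly.ParallelizableAvatar

end
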